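import Mathlib
import HarnessLib
import Summits.HubbardSuperconductivity.HubbardSuperconductivity.Theorems.KLProgrammeKLRegimeCountertermJacksonFrameBounds

/-!
# Route `KLProgramme`, crux K3 — gen-5 ENGINE child (`stub_twoLeg_step`, (E3a-MS) supplier, recipe (L)+(F) of plan g12 STATUS l.1769):
# the Jackson mean to SECOND ORDER — second moment of the kernel and `|𝒥_d F − F| ≤ 2π⁷·‖D²F‖∞/(d+1)²`

Seat hubbard-kl-k3c3-p1 (g3), package (P1) «Jackson toolkit additions» of MS-DESIGN-NOTE §4 (evidence #29 on stmt-…-19855).  The (F) frequency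
split of the (E3a-MS) witness splits each mean-free deep frame piece at degree `d = 4ⁿ` into the low part `2𝒥_d − 𝒥_d²` and the high part
`(1 − 𝒥_d)²`; the high part must be small in sup norm by `d^{−l}·‖Dˡ·‖` for `l ≤ 4`, which is obtained by ITERATING an order-2 estimate for the
even positive kernel (k3c3-p2's `…JacksonFrameBounds` has order 1, `abs_jsmooth_sub_self_le`: one gradient, `π⁶B₁/(d+1)`).  This file:

* §1 `sq_mul_jackson_le` (`x²·J_d(x) ≤ (π⁴/4)/((d+1)(1+((d+1)x)²))` on `|x| ≤ ½`, from the tree's `jackson_le_inv` / k3c3-p2's `jackson_le_const`),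
  **`integral_sq_mul_jker_le`**: `∫_{−π}^{π} s²·J̃_d(s) ds ≤ π⁷/(d+1)²`; `integral_mul_jker_eq_zero` (`∫ s·J̃_d = 0`, evenness);
* §2 the second-order Taylor bound in a real normed space, `norm_sub_sub_fderiv_le` : `|G(x − w) − G(x) + DG(x)w| ≤ B₂‖w‖²` for `G ∈ C²` with
  `‖D²G‖ ≤ B₂` (mean value theorem twice);
* §3 **`abs_jsmooth_sub_self_le_of_second`**: `|𝒥_d F(p) − F(p)| ≤ 2π⁷/(d+1)²·B₂` for `F` continuous with `F ∘ ofLp ∈ C²(ℝ²)`, `‖D²(F∘ofLp)‖ ≤ B₂`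
  — the first-order term integrates to zero against the even kernel, the remainder against `s² + t²`.

Pure real analysis; nothing about the model.  References: DeVore–Lorentz, Constructive Approximation, Ch. 7 §2 (Jackson's theorem via the Jackson
kernel); k3c3-p2 `…CountertermJacksonKernel/Frame/FrameBounds`.
-/

noncomputable section

namespace Summit.HubbardSuperconductivity.HubbardSuperconductivity.Theorems.KLRegimeSplit

set_option linter.dupNamespace false -- summit = problem name (single-conjunct summit), D-0017

open Real Finset MeasureTheory intervalIntegral
open Literature.Analysis.Fourier.TrigApprox Literature.MathematicalPhysics.QuantumLattice

/-! ## §1 The second moment of the kernel -/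

/-- The pointwise second-moment majorant: `x²·J_d(x) ≤ (π⁴/4)/((d+1)·(1 + ((d+1)x)²))` on `|x| ≤ ½`. -/
theorem sq_mul_jackson_le (d : ℕ) {x : ℝ} (hx : |x| ≤ 1 / 2) :
    x ^ 2 * jackson d x ≤ (π ^ 4 / 4) / ((d + 1) * (1 + ((d + 1) * x) ^ 2)) := by
  have hJ0 := jackson_nonneg d x
  have hd : (0 : ℝ) < d + 1 := by positivity
  have hπ4 : (0 : ℝ) < π ^ 4 := by positivity
  rw [le_div_iff₀ (by positivity)]
  set y := (d + 1) * |x| with hy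
  have hy0 : 0 ≤ y := by positivity
  have hysq : ((d + 1) * x) ^ 2 = y ^ 2 := by rw [hy, mul_pow, mul_pow, sq_abs]
  have hx2 : x ^ 2 = |x| ^ 2 := (sq_abs x).symm
  rw [hysq]
  rcases le_or_gt y 1 with h1 | h1
  · -- near the origin: `J ≤ π⁴(d+1)/8`
    have hJ := jackson_le_const d x
    have hx2y : x ^ 2 * (d + 1) = y * |x| := by rw [hx2, hy]; ring
    calc x ^ 2 * jackson d x * ((d + 1) * (1 + y ^ 2)) = (x ^ 2 * (d + 1)) * jackson d x * (1 + y ^ 2) := by ring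
      _ ≤ (x ^ 2 * (d + 1)) * (π ^ 4 * (d + 1) / 8) * (1 + 1) := by gcongr; nlinarith
      _ = π ^ 4 / 4 * (y * (y * 1)) := by rw [hx2, hy]; ring
      _ ≤ π ^ 4 / 4 := by nlinarith [mul_le_one₀ h1 hy0 h1]
  · -- tail: `J ≤ π⁴/(128 (d+1)³ x⁴)`
    have hx0 : x ≠ 0 := by
      intro h0; rw [h0, abs_zero, mul_zero] at hy; rw [hy] at h1; linarith
    have hJ := jackson_le_inv d hx0 hx
    have hxpos : 0 < |x| := abs_pos.mpr hx0
    have hx4 : x ^ 4 = |x| ^ 4 := (Even.pow_abs (by decide) x).symm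
    have key : x ^ 2 * jackson d x * ((d + 1) * (1 + y ^ 2)) ≤
        x ^ 2 * (π ^ 4 / (128 * (d + 1) ^ 3 * x ^ 4)) * ((d + 1) * (1 + y ^ 2)) := by gcongr
    have hy2 : (d + 1 : ℝ) ^ 2 * |x| ^ 2 = y ^ 2 := by rw [hy]; ring
    have : x ^ 2 * (π ^ 4 / (128 * (d + 1) ^ 3 * x ^ 4)) * ((d + 1) * (1 + y ^ 2)) = π ^ 4 * (1 + y ^ 2) / (128 * y ^ 2) := by
      rw [hx4, hx2, ← hy2]; field_simp
    rw [this] at key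
    have hyy : (1 + y ^ 2) * 4 ≤ 128 * y ^ 2 := by nlinarith
    have hfrac : π ^ 4 * (1 + y ^ 2) / (128 * y ^ 2) ≤ π ^ 4 / 4 := by
      rw [div_le_div_iff₀ (by positivity) (by positivity)]
      nlinarith [mul_le_mul_of_nonneg_left hyy hπ4.le]
    exact key.trans hfrac

/-- **Second moment**: `∫_{−π}^{π} s²·J̃_d(s) ds ≤ π⁷/(d+1)²`. -/
theorem integral_sq_mul_jker_le (d : ℕ) : ∫ s in (-π)..π, s ^ 2 * jker d s ≤ π ^ 7 / (d + 1) ^ 2 := by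
  have h2π : (2 * π : ℝ) ≠ 0 := by positivity
  have hd : (0 : ℝ) < d + 1 := by positivity
  -- substitution `s = 2π x`
  have hsub : ∫ s in (-π)..π, s ^ 2 * jker d s = (2 * π) ^ 2 * ∫ x in (-(1 / 2 : ℝ))..(1 / 2), x ^ 2 * jackson d x := by
    have hpt : ∀ s, s ^ 2 * jker d s = (2 * π) * (fun x => x ^ 2 * jackson d x) (s / (2 * π)) := by
      intro s
      simp only [jker]
      field_simp
    rw [intervalIntegral.integral_congr fun s _ => hpt s, intervalIntegral.integral_const_mul,
      intervalIntegral.integral_comp_div (fun x => x ^ 2 * jackson d x) h2π,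
      show -π / (2 * π) = -(1 / 2 : ℝ) by field_simp, show π / (2 * π) = (1 / 2 : ℝ) by field_simp, smul_eq_mul]
    ring
  rw [hsub]
  -- the pointwise majorant
  have hcont : Continuous fun x : ℝ => (π ^ 4 / 4) / ((d + 1) * (1 + ((d + 1) * x) ^ 2)) :=
    continuous_const.div (by fun_prop) fun x => by positivity
  have hmaj : ∫ x in (-(1 / 2 : ℝ))..(1 / 2), x ^ 2 * jackson d x ≤
      ∫ x in (-(1 / 2 : ℝ))..(1 / 2), (π ^ 4 / 4) / ((d + 1) * (1 + ((d + 1) * x) ^ 2)) := by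
    refine intervalIntegral.integral_mono_on (by norm_num)
      (((continuous_pow 2).mul (continuous_jackson d)).intervalIntegrable _ _) (hcont.intervalIntegrable _ _)
      fun x hx => sq_mul_jackson_le d ?_
    rw [abs_le]; exact ⟨by linarith [hx.1], by linarith [hx.2]⟩
  -- the arctangent integral
  have harc : ∫ x in (-(1 / 2 : ℝ))..(1 / 2), (π ^ 4 / 4) / ((d + 1) * (1 + ((d + 1) * x) ^ 2)) ≤
      (π ^ 4 / 4 / (d + 1)) * (π / (d + 1)) := by
    have hfun : (fun x : ℝ => (π ^ 4 / 4) / ((d + 1) * (1 + ((d + 1) * x) ^ 2))) =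
        fun x => (π ^ 4 / 4 / (d + 1)) * ((fun y : ℝ => (1 + y ^ 2)⁻¹) ((d + 1) * x)) := by
      funext x; field_simp
    rw [hfun, intervalIntegral.integral_const_mul,
      intervalIntegral.integral_comp_mul_left (fun y : ℝ => (1 + y ^ 2)⁻¹) hd.ne', integral_inv_one_add_sq, smul_eq_mul]
    have h1 := Real.arctan_lt_pi_div_two ((d + 1 : ℝ) * (1 / 2))
    have h2 := Real.neg_pi_div_two_lt_arctan ((d + 1 : ℝ) * -(1 / 2))
    have hπ4 : (0 : ℝ) ≤ π ^ 4 / 4 / (d + 1) := by positivity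
    apply mul_le_mul_of_nonneg_left _ hπ4
    rw [inv_mul_le_iff₀ hd, show (d + 1 : ℝ) * (π / (d + 1)) = π by field_simp]
    linarith
  calc (2 * π) ^ 2 * ∫ x in (-(1 / 2 : ℝ))..(1 / 2), x ^ 2 * jackson d x
      ≤ (2 * π) ^ 2 * ((π ^ 4 / 4 / (d + 1)) * (π / (d + 1))) :=
        mul_le_mul_of_nonneg_left (hmaj.trans harc) (by positivity)
    _ = π ^ 7 / (d + 1) ^ 2 := by field_simp; ring

/-- The odd moment vanishes: `∫_{−π}^{π} s·J̃_d(s) ds = 0` (the kernel is even). -/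
theorem integral_mul_jker_eq_zero (d : ℕ) : ∫ s in (-π)..π, s * jker d s = 0 :=
  integral_eq_zero_of_odd (fun s => by rw [jker_neg]; ring) π

/-! ## §2 The second-order Taylor bound in a real normed space -/

section Taylor

variable {E : Type*} [NormedAddCommGroup E] [NormedSpace ℝ E] {G : E → ℝ}

/-- `‖D(DG)(y)‖ = ‖D²G(y)‖` (operator norm of the second Fréchet derivative, curried or not). -/
theorem norm_fderiv_fderiv_eq_norm_iteratedFDeriv_two (G : E → ℝ) (y : E) :
    ‖fderiv ℝ (fderiv ℝ G) y‖ = ‖iteratedFDeriv ℝ 2 G y‖ := by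
  rw [← norm_iteratedFDeriv_zero (𝕜 := ℝ) (f := fderiv ℝ (fderiv ℝ G)) (x := y), norm_iteratedFDeriv_fderiv,
    norm_iteratedFDeriv_fderiv]

/-- The gradient of a `C²` function is `B₂`-Lipschitz when `‖D²G‖ ≤ B₂`. -/
theorem norm_fderiv_sub_fderiv_le_of_iteratedFDeriv_two (hG : ContDiff ℝ 2 G) {B₂ : ℝ} (hB : ∀ y, ‖iteratedFDeriv ℝ 2 G y‖ ≤ B₂)
    (x y : E) : ‖fderiv ℝ G x - fderiv ℝ G y‖ ≤ B₂ * ‖x - y‖ := by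
  have h1 : ContDiff ℝ 1 (fderiv ℝ G) := hG.fderiv_right (m := 1) (by norm_num)
  have hdiff : Differentiable ℝ (fderiv ℝ G) := h1.differentiable (by norm_num)
  exact Convex.norm_image_sub_le_of_norm_fderiv_le (fun z _ => hdiff z)
    (fun z _ => by rw [norm_fderiv_fderiv_eq_norm_iteratedFDeriv_two]; exact hB z) convex_univ (Set.mem_univ y) (Set.mem_univ x)

/-- **Second-order Taylor bound**: `|G(x − w) − G(x) + DG(x)w| ≤ B₂‖w‖²` for `G ∈ C²` with `‖D²G‖ ≤ B₂` (mean value theorem for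
`τ ↦ G(x − τw)` on `[0,1]`, then the Lipschitz bound of the gradient). -/
theorem abs_sub_sub_add_fderiv_le (hG : ContDiff ℝ 2 G) {B₂ : ℝ} (hB : ∀ y, ‖iteratedFDeriv ℝ 2 G y‖ ≤ B₂) (x w : E) :
    |G (x - w) - G x + fderiv ℝ G x w| ≤ B₂ * ‖w‖ ^ 2 := by
  have hGd : Differentiable ℝ G := hG.differentiable (by norm_num)
  set g : ℝ → ℝ := fun τ => G (x - τ • w) with hg_def
  have hg : ∀ τ, HasDerivAt g (-(fderiv ℝ G (x - τ • w) w)) τ := by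
    intro τ
    have h1 : HasDerivAt (fun τ : ℝ => x - τ • w) (-w) τ := by
      have := ((hasDerivAt_id τ).smul_const w).const_sub x
      simpa using this
    have h2 : HasDerivAt (G ∘ fun τ : ℝ => x - τ • w) (fderiv ℝ G (x - τ • w) (-w)) τ :=
      (hGd (x - τ • w)).hasFDerivAt.comp_hasDerivAt τ h1
    rw [map_neg] at h2
    exact h2
  have hgc : ContinuousOn g (Set.Icc 0 1) := fun τ _ => (hg τ).continuousAt.continuousWithinAt
  obtain ⟨ξ, hξ, hslope⟩ := exists_hasDerivAt_eq_slope g (fun τ => -(fderiv ℝ G (x - τ • w) w)) zero_lt_one hgc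
    (fun τ _ => hg τ)
  have hg1 : g 1 = G (x - w) := by simp [hg_def]
  have hg0 : g 0 = G x := by simp [hg_def]
  rw [hg1, hg0, sub_zero, div_one] at hslope
  -- `G(x−w) − G(x) + DG(x)w = (DG(x) − DG(x − ξw)) w`
  have hid : G (x - w) - G x + fderiv ℝ G x w = (fderiv ℝ G x - fderiv ℝ G (x - ξ • w)) w := by
    rw [show (fderiv ℝ G x - fderiv ℝ G (x - ξ • w)) w = fderiv ℝ G x w - fderiv ℝ G (x - ξ • w) w from rfl, ← hslope]
    ring
  rw [hid, ← Real.norm_eq_abs]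
  have hlip := norm_fderiv_sub_fderiv_le_of_iteratedFDeriv_two hG hB x (x - ξ • w)
  have hξ1 : ‖x - (x - ξ • w)‖ ≤ ‖w‖ := by
    rw [sub_sub_cancel, norm_smul, Real.norm_eq_abs, abs_of_pos hξ.1]
    exact mul_le_of_le_one_left (norm_nonneg _) hξ.2.le
  have hB0 : 0 ≤ B₂ := le_trans (norm_nonneg _) (hB x)
  calc ‖(fderiv ℝ G x - fderiv ℝ G (x - ξ • w)) w‖ ≤ ‖fderiv ℝ G x - fderiv ℝ G (x - ξ • w)‖ * ‖w‖ :=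
        ContinuousLinearMap.le_opNorm _ _
    _ ≤ B₂ * ‖x - (x - ξ • w)‖ * ‖w‖ := mul_le_mul_of_nonneg_right hlip (norm_nonneg _)
    _ ≤ B₂ * ‖w‖ * ‖w‖ := by gcongr
    _ = B₂ * ‖w‖ ^ 2 := by ring

end Taylor

/-! ## §3 The value error of the Jackson mean to second order -/

section SecondOrder

variable (d : ℕ) {F : (Fin 2 → ℝ) → ℝ}

/-- Translates read through `EuclideanSpace`: `F(p₀ − s, p₁ − t) = (F ∘ ofLp)(toLp p − toLp (s,t))`. -/
theorem apply_sub_eq_comp_ofLp (F : (Fin 2 → ℝ) → ℝ) (p : Fin 2 → ℝ) (s t : ℝ) :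
    F ![p 0 - s, p 1 - t] =
      (fun q : EuclideanSpace ℝ (Fin 2) => F (WithLp.ofLp q)) (WithLp.toLp 2 p - WithLp.toLp 2 ![s, t]) := by
  simp only [← WithLp.toLp_sub, WithLp.ofLp_toLp]
  congr 1
  ext i; fin_cases i <;> simp

/-- `‖toLp (s,t)‖² = s² + t²`. -/
theorem norm_toLp_pair_sq (s t : ℝ) : ‖(WithLp.toLp 2 ![s, t] : EuclideanSpace ℝ (Fin 2))‖ ^ 2 = s ^ 2 + t ^ 2 := by
  rw [EuclideanSpace.norm_eq, Real.sq_sqrt (by positivity)]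
  simp [Fin.sum_univ_two]

/-- The first-order term is linear in `(s,t)`: `DG(x)(toLp (s,t)) = s·DG(x)(e₀) + t·DG(x)(e₁)`. -/
theorem fderiv_toLp_pair (G : EuclideanSpace ℝ (Fin 2) → ℝ) (x : EuclideanSpace ℝ (Fin 2)) (s t : ℝ) :
    fderiv ℝ G x (WithLp.toLp 2 ![s, t]) =
      s * fderiv ℝ G x (WithLp.toLp 2 ![1, 0]) + t * fderiv ℝ G x (WithLp.toLp 2 ![0, 1]) := by
  have h : (WithLp.toLp 2 ![s, t] : EuclideanSpace ℝ (Fin 2)) =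
      s • WithLp.toLp 2 ![1, 0] + t • WithLp.toLp 2 ![0, 1] := by
    ext i; fin_cases i <;> simp
  rw [h, map_add, map_smul, map_smul, smul_eq_mul, smul_eq_mul]

/-- **The value error of the Jackson mean to SECOND order**: `|𝒥_d F(p) − F(p)| ≤ 2π⁷/(d+1)²·B₂` for `F` continuous with
`G = F ∘ ofLp ∈ C²(ℝ²)` (Euclidean) and `‖D²G‖ ≤ B₂` — the first-order term integrates to zero against the EVEN kernel, the second-order
remainder against `s² + t²` (`integral_sq_mul_jker_le`).  Two derivatives are spent, `d` is free. -/
theorem abs_jsmooth_sub_self_le_of_second (hF : Continuous F)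
    (hG : ContDiff ℝ 2 (fun q : EuclideanSpace ℝ (Fin 2) => F (WithLp.ofLp q))) {B₂ : ℝ}
    (hB : ∀ x, ‖iteratedFDeriv ℝ 2 (fun q : EuclideanSpace ℝ (Fin 2) => F (WithLp.ofLp q)) x‖ ≤ B₂) (p : Fin 2 → ℝ) :
    |jsmooth d F p - F p| ≤ 2 * π ^ 7 / (d + 1) ^ 2 * B₂ := by
  have hππ : -π ≤ π := by linarith [Real.pi_pos]
  set G : EuclideanSpace ℝ (Fin 2) → ℝ := fun q => F (WithLp.ofLp q) with hGdef
  set x : EuclideanSpace ℝ (Fin 2) := WithLp.toLp 2 p with hx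
  set a : ℝ := fderiv ℝ G x (WithLp.toLp 2 ![1, 0]) with ha
  set b : ℝ := fderiv ℝ G x (WithLp.toLp 2 ![0, 1]) with hb
  have hB0 : 0 ≤ B₂ := le_trans (norm_nonneg _) (hB x)
  set M : ℝ := π ^ 7 / (d + 1) ^ 2 with hM
  have hM2 := integral_sq_mul_jker_le d
  -- the pointwise second-order bound with the linear term added back
  have hpt : ∀ s t, |jker d s * jker d t * (F ![p 0 - s, p 1 - t] - F p) + jker d s * jker d t * (a * s + b * t)| ≤
      jker d s * jker d t * (B₂ * (s ^ 2 + t ^ 2)) := by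
    intro s t
    have hT := abs_sub_sub_add_fderiv_le hG hB x (WithLp.toLp 2 ![s, t])
    rw [norm_toLp_pair_sq, fderiv_toLp_pair] at hT
    have hF1 : F ![p 0 - s, p 1 - t] = G (x - WithLp.toLp 2 ![s, t]) := apply_sub_eq_comp_ofLp F p s t
    have hF0 : F p = G x := by simp [hGdef, hx]
    rw [hF1, hF0, ← mul_add, abs_mul, abs_of_nonneg (mul_nonneg (jker_nonneg d s) (jker_nonneg d t))]
    refine mul_le_mul_of_nonneg_left ?_ (mul_nonneg (jker_nonneg d s) (jker_nonneg d t))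
    have : G (x - WithLp.toLp 2 ![s, t]) - G x + (a * s + b * t) =
        G (x - WithLp.toLp 2 ![s, t]) - G x + (s * a + t * b) := by ring
    rw [this]; exact hT
  -- `𝒥F(p) − F(p) = 𝒥(F − F(p))(p)`
  have hc : Continuous fun q : Fin 2 → ℝ => F q - F p := hF.sub continuous_const
  have hrepr : jsmooth d F p - F p = jsmooth d (fun q => F q - F p) p := by
    rw [jsmooth_sub d hF continuous_const, jsmooth_const]
  -- the linear term integrates to zero
  have hlin_inner : ∀ s, ∫ t in (-π)..π, jker d s * jker d t * (a * s + b * t) = jker d s * (a * s) := by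
    intro s
    have e : (fun t => jker d s * jker d t * (a * s + b * t)) =
        fun t => jker d s * (a * s) * jker d t + jker d s * b * (t * jker d t) := by
      funext t; ring
    have i1 : IntervalIntegrable (fun t => jker d s * (a * s) * jker d t) volume (-π) π :=
      (continuous_const.mul (continuous_jker d)).intervalIntegrable _ _
    have i2 : IntervalIntegrable (fun t => jker d s * b * (t * jker d t)) volume (-π) π :=
      (continuous_const.mul (continuous_id.mul (continuous_jker d))).intervalIntegrable _ _
    rw [e, intervalIntegral.integral_add i1 i2,
      intervalIntegral.integral_const_mul, intervalIntegral.integral_const_mul, integral_jker, integral_mul_jker_eq_zero]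
    ring
  have hlin : ∫ s in (-π)..π, ∫ t in (-π)..π, jker d s * jker d t * (a * s + b * t) = 0 := by
    simp_rw [hlin_inner]
    have e : (fun s => jker d s * (a * s)) = fun s => a * (s * jker d s) := by funext s; ring
    rw [e, intervalIntegral.integral_const_mul, integral_mul_jker_eq_zero, mul_zero]
  -- combine
  rw [hrepr]
  unfold jsmooth
  rw [show (∫ s in (-π)..π, ∫ t in (-π)..π, jker d s * jker d t * (F ![p 0 - s, p 1 - t] - F p)) =
      (∫ s in (-π)..π, ∫ t in (-π)..π, jker d s * jker d t * (F ![p 0 - s, p 1 - t] - F p)) +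
        ∫ s in (-π)..π, ∫ t in (-π)..π, jker d s * jker d t * (a * s + b * t) by rw [hlin, add_zero]]
  -- merge the two double integrals
  have hcontL : Continuous (Function.uncurry fun s t : ℝ => jker d s * jker d t * (a * s + b * t)) := by
    exact (((continuous_jker d).comp continuous_fst).mul ((continuous_jker d).comp continuous_snd)).mul
      ((continuous_const.mul continuous_fst).add (continuous_const.mul continuous_snd))
  have hinner_add : ∀ s, (∫ t in (-π)..π, jker d s * jker d t * (F ![p 0 - s, p 1 - t] - F p)) +
      (∫ t in (-π)..π, jker d s * jker d t * (a * s + b * t)) =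
      ∫ t in (-π)..π, (jker d s * jker d t * (F ![p 0 - s, p 1 - t] - F p) + jker d s * jker d t * (a * s + b * t)) := by
    intro s
    have i1 : IntervalIntegrable (fun t => jker d s * jker d t * (F ![p 0 - s, p 1 - t] - F p)) volume (-π) π :=
      (continuous_jsmoothIntegrand_snd d hc p s).intervalIntegrable _ _
    have i2 : IntervalIntegrable (fun t => jker d s * jker d t * (a * s + b * t)) volume (-π) π :=
      (hcontL.comp (Continuous.prodMk_right s)).intervalIntegrable _ _
    rw [← intervalIntegral.integral_add i1 i2]
  have j1 : IntervalIntegrable (fun s => ∫ t in (-π)..π, jker d s * jker d t * (F ![p 0 - s, p 1 - t] - F p)) volume (-π) π :=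
    (continuous_jsmoothInner d hc p).intervalIntegrable _ _
  have j2 : IntervalIntegrable (fun s => ∫ t in (-π)..π, jker d s * jker d t * (a * s + b * t)) volume (-π) π :=
    (intervalIntegral.continuous_parametric_intervalIntegral_of_continuous' hcontL _ _).intervalIntegrable _ _
  rw [← intervalIntegral.integral_add j1 j2]
  simp_rw [hinner_add]
  -- inner bound
  have hcontS : Continuous (Function.uncurry fun s t : ℝ =>
      jker d s * jker d t * (F ![p 0 - s, p 1 - t] - F p) + jker d s * jker d t * (a * s + b * t)) :=
    (continuous_jsmoothIntegrand d hc p).add hcontL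
  have hinner : ∀ s, |∫ t in (-π)..π, (jker d s * jker d t * (F ![p 0 - s, p 1 - t] - F p) +
      jker d s * jker d t * (a * s + b * t))| ≤ jker d s * (B₂ * (s ^ 2 + M)) := by
    intro s
    have hjs := jker_nonneg d s
    calc |∫ t in (-π)..π, (jker d s * jker d t * (F ![p 0 - s, p 1 - t] - F p) + jker d s * jker d t * (a * s + b * t))|
        ≤ ∫ t in (-π)..π, |jker d s * jker d t * (F ![p 0 - s, p 1 - t] - F p) + jker d s * jker d t * (a * s + b * t)| :=
          intervalIntegral.abs_integral_le_integral_abs hππ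
      _ ≤ ∫ t in (-π)..π, jker d s * B₂ * s ^ 2 * jker d t + jker d s * B₂ * (t ^ 2 * jker d t) := by
          refine intervalIntegral.integral_mono_on hππ
            ((hcontS.comp (Continuous.prodMk_right s)).abs.intervalIntegrable _ _)
            (Continuous.intervalIntegrable
              ((continuous_const.mul (continuous_jker d)).add
                (continuous_const.mul ((continuous_pow 2).mul (continuous_jker d)))) _ _)
            fun t _ => ?_
          have h := hpt s t
          have e : jker d s * jker d t * (B₂ * (s ^ 2 + t ^ 2)) =
              jker d s * B₂ * s ^ 2 * jker d t + jker d s * B₂ * (t ^ 2 * jker d t) := by ring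
          rw [← e]; exact h
      _ = jker d s * B₂ * s ^ 2 + jker d s * B₂ * ∫ t in (-π)..π, t ^ 2 * jker d t := by
          have i1 : IntervalIntegrable (fun t => jker d s * B₂ * s ^ 2 * jker d t) volume (-π) π :=
            (continuous_const.mul (continuous_jker d)).intervalIntegrable _ _
          have i2 : IntervalIntegrable (fun t => jker d s * B₂ * (t ^ 2 * jker d t)) volume (-π) π :=
            (continuous_const.mul ((continuous_pow 2).mul (continuous_jker d))).intervalIntegrable _ _
          rw [intervalIntegral.integral_add i1 i2, intervalIntegral.integral_const_mul, intervalIntegral.integral_const_mul,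
            integral_jker, mul_one]
      _ ≤ jker d s * (B₂ * (s ^ 2 + M)) := by
          have : jker d s * B₂ * ∫ t in (-π)..π, t ^ 2 * jker d t ≤ jker d s * B₂ * M :=
            mul_le_mul_of_nonneg_left hM2 (mul_nonneg hjs hB0)
          nlinarith
  -- outer bound
  calc |∫ s in (-π)..π, ∫ t in (-π)..π, (jker d s * jker d t * (F ![p 0 - s, p 1 - t] - F p) +
        jker d s * jker d t * (a * s + b * t))|
      ≤ ∫ s in (-π)..π, |∫ t in (-π)..π, (jker d s * jker d t * (F ![p 0 - s, p 1 - t] - F p) +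
          jker d s * jker d t * (a * s + b * t))| := intervalIntegral.abs_integral_le_integral_abs hππ
    _ ≤ ∫ s in (-π)..π, B₂ * (s ^ 2 * jker d s) + B₂ * M * jker d s := by
        refine intervalIntegral.integral_mono_on hππ
          ((intervalIntegral.continuous_parametric_intervalIntegral_of_continuous' hcontS _ _).abs.intervalIntegrable _ _)
          (Continuous.intervalIntegrable ((continuous_const.mul ((continuous_pow 2).mul (continuous_jker d))).add
            (continuous_const.mul (continuous_jker d))) _ _)
          fun s _ => ?_
        have h := hinner s
        have e : jker d s * (B₂ * (s ^ 2 + M)) = B₂ * (s ^ 2 * jker d s) + B₂ * M * jker d s := by ring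
        rw [← e]; exact h
    _ = B₂ * (∫ s in (-π)..π, s ^ 2 * jker d s) + B₂ * M := by
        have k1 : IntervalIntegrable (fun s => B₂ * (s ^ 2 * jker d s)) volume (-π) π :=
          (continuous_const.mul ((continuous_pow 2).mul (continuous_jker d))).intervalIntegrable _ _
        have k2 : IntervalIntegrable (fun s => B₂ * M * jker d s) volume (-π) π :=
          (continuous_const.mul (continuous_jker d)).intervalIntegrable _ _
        rw [intervalIntegral.integral_add k1 k2, intervalIntegral.integral_const_mul,
          intervalIntegral.integral_const_mul, integral_jker, mul_one]
    _ ≤ B₂ * M + B₂ * M := by nlinarith [mul_le_mul_of_nonneg_left hM2 hB0]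
    _ = 2 * π ^ 7 / (d + 1) ^ 2 * B₂ := by rw [hM]; ring

end SecondOrder

end Summit.HubbardSuperconductivity.HubbardSuperconductivity.Theorems.KLRegimeSplit

end
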